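import Literature.Probability.Percolation.LandedAltPivotalSum
import Literature.Probability.Percolation.AltFourArmGlue
import Literature.Probability.Percolation.AltPivotalLowerBound
import Literature.Probability.Percolation.FourArmStabilityFromAltPattern
import Literature.Probability.Percolation.HalfPlaneTwoArmRadiiNearCritical
import Literature.Probability.Percolation.WernerDifferentialInequalities
import HarnessLib

/-!
# Werner's Lemma 6.3 for the alternating `π̂`: `π̂^alt_p(n) ≍ π̂^alt_{1/2}(n)` below `L(p)` (proofs only)

Topic `Literature/Probability/Percolation`; family `crit-perc`. PROOFS ONLY (no definition, no
named fact). The assembly of W. Werner, *Lectures on two-dimensional critical percolation*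
(PCMI 2009), Lecture 6, **Lemma 6.3** ("`|d/dp π̂_p(n)| ≤ c π̂_p(n) · d/dp h_p(n)`; integrating
between `1/2` and `p`, `π̂_p(n) ≍ π̂(n)` for `n ≤ L(p)`") for Werner's own ALTERNATING `π̂`
(`altFourArmProbAt`, arXiv 0710.0856 p. 38: "4 arms (open, closed, open, closed) ordered in this
way"), from

* `hsepA` — near-critical ALTERNATING four-arm separation `c π̂^alt_t(n, N) ≤ P_t(sepFourArm n N)`
  below `L(t, ε)` (Werner §4 first exercise session / Nolin 2008 Thm. 11 for `σ = BWBW`; the one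
  displayed input of the whole alternating programme), and
* `hLB` — the a priori lower bound `c (m/n)^{2-β} ≤ π̂^alt_t(m, n)` below `L(t, ε)` (Werner §3,
  third estimate, via five arms; displayed in the shape used by `NearCriticalOneArmFromAltFacts.lean`),

through the LANDED alternating event `E = landedAltFourArm r₀ N` (cut-point pivotals, no duality):
`Σ_v P_t(v pivotal for E) ≤ K N² π̂^alt_t P_t(E)` (`landedPivotalSum_le`, its host inputs supplied
here from `hsepA` by Kesten's gluing `sepFour_mul_sepFour_mul_glue_le_landed_at`, its kernel inputs
by `altFourArm_quasiMult_of_altSeparation` and `hLB`, its half-plane input by the theorem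
`Werner2009_halfPlane_twoArm_holds`), `c N² π̂^alt_t ≤ Σ_x P_t(x pivotal for LR(2N,N))`
(`paraPivotalSum_lower_alt_of_altSeparation`), Russo + Grönwall
(`real_ratio_le_exp_of_pivotal_bound`): `P_p(E) ≍ P_{1/2}(E)`; and the sandwich
`c_E π̂^alt_s(r₀, N) ≤ P_s(E) ≤ π̂^alt_s(r₀, N)` at `s = p, 1/2`:

* `altFourArm_stability_of_altSeparation` — Lemma 6.3 for `π̂^alt` in the `∀∃` shape of the
  tree's `Werner2009_lemma63`.

(The tree's ORDER-FREE named fact `Werner2009_lemma63` from `hsepA` and the near-critical bridge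
`c π̂_t ≤ π̂^alt_t` is already `Werner2009_lemma63_of_altSeparation_of_bridge`,
`FourArmStabilityFromAltPattern.lean` — no a priori lower bound needed; from Lemma 6.3 for
`π̂^alt` and the bridge it is `Werner2009_lemma63_of_altStability_of_bridge` there.)

## References

* W. Werner, *Lectures on two-dimensional critical percolation*, IAS/Park City Math. Ser. 16
  (2009), Lecture 6, Lemma 6.3 and §5; Lecture 3 (a priori bounds); §4 (separation)
  [WernerPCMI2009].
* P. Nolin, Near-critical percolation in two dimensions, *Electron. J. Probab.* 13 (2008), Thm. 11,
  Prop. 12, §6.2 Thm. 27 (arXiv 0711.4948: Thm. 10, Prop. 11, Thm. 26) [Nolin2008].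
* H. Kesten, Scaling relations for 2D-percolation, *Comm. Math. Phys.* 109 (1987), Lemma 8
  [KestenScalingCMP1987].
-/

noncomputable section

open MeasureTheory unitInterval Set

namespace Literature.Probability.Percolation

open LatticeModels

set_option maxHeartbeats 1600000 in
/-- **Werner's Lemma 6.3 for the alternating `π̂`, from alternating separation and the a priori
lower bound.** For every small `ε` there is `r₁` such that for every `r₀ ≥ r₁` there are `n₁`,
`δ > 0`, `0 < c ≤ C` with `c π̂^alt_{1/2}(r₀, N) ≤ π̂^alt_t(r₀, N) ≤ C π̂^alt_{1/2}(r₀, N)` for all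
`1/2 ≤ t < 1/2 + δ`, `n₁ ≤ N`, and `N ≤ L(t, ε)` if `t > 1/2`. Proof: Werner 2009, Lecture 6, §5
through the landed event (module docstring). [cite: WernerPCMI2009, Lecture 6, Lemma 6.3 and §5] [cite: Nolin2008, §6.2 Thm. 27 (arXiv 0711.4948: Thm. 26)] -/
theorem altFourArm_stability_of_altSeparation
    (hsepA : ∃ ε₁ > (0 : ℝ), ∀ ⦃ε : ℝ⦄, 0 < ε → ε < ε₁ →
      ∃ n₀ : ℕ, ∃ δ > (0 : ℝ), ∃ c > (0 : ℝ),
        ∀ t : unitInterval, 1 / 2 ≤ (t : ℝ) → (t : ℝ) < 1 / 2 + δ →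
          ∀ n N : ℕ, n₀ ≤ n → 2 * n ≤ N → (1 / 2 < (t : ℝ) → N ≤ charLengthW ε t) →
            c * altFourArmProbAt t n N ≤ (triSitePercolation t).real (sepFourArm n N))
    (hLB : ∃ ε₁ > (0 : ℝ), ∀ ⦃ε : ℝ⦄, 0 < ε → ε < ε₁ →
      ∃ r₁ : ℕ, ∃ δ > (0 : ℝ), ∃ β > (0 : ℝ), ∃ c > (0 : ℝ),
        ∀ t : unitInterval, 1 / 2 ≤ (t : ℝ) → (t : ℝ) < 1 / 2 + δ →
          ∀ m n : ℕ, r₁ ≤ m → m ≤ n → (1 / 2 < (t : ℝ) → n ≤ charLengthW ε t) →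
            c * ((m : ℝ) / n) ^ (2 - β) ≤ altFourArmProbAt t m n) :
    ∃ ε₁ > (0 : ℝ), ∀ ⦃ε : ℝ⦄, 0 < ε → ε < ε₁ →
      ∃ r₁ : ℕ, ∀ r₀ ≥ r₁, ∃ n₁ : ℕ, ∃ δ > (0 : ℝ), ∃ c > (0 : ℝ), ∃ C : ℝ,
        ∀ t : unitInterval, 1 / 2 ≤ (t : ℝ) → (t : ℝ) < 1 / 2 + δ →
          ∀ N : ℕ, n₁ ≤ N → (1 / 2 < (t : ℝ) → N ≤ charLengthW ε t) →
            c * altFourArmProbAt half r₀ N ≤ altFourArmProbAt t r₀ N ∧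
              altFourArmProbAt t r₀ N ≤ C * altFourArmProbAt half r₀ N := by
  classical
  have hQM := altFourArm_quasiMult_of_altSeparation hsepA
  have hPS := paraPivotalSum_lower_alt_of_altSeparation hsepA
  obtain ⟨εs, hεs, HS⟩ := hsepA
  obtain ⟨εQ, hεQ, HQ⟩ := hQM
  obtain ⟨εL, hεL, HL⟩ := hLB
  obtain ⟨εH, hεH, HH⟩ := Werner2009_halfPlane_twoArm_holds
  obtain ⟨εP, hεP, HP⟩ := hPS
  refine ⟨min (min (min εs εQ) (min εL εH)) εP, by positivity, fun ε hε hε₁ => ?_⟩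
  have hεs' : ε < εs := hε₁.trans_le ((min_le_left _ _).trans ((min_le_left _ _).trans (min_le_left _ _)))
  have hεQ' : ε < εQ := hε₁.trans_le ((min_le_left _ _).trans ((min_le_left _ _).trans (min_le_right _ _)))
  have hεL' : ε < εL := hε₁.trans_le ((min_le_left _ _).trans ((min_le_right _ _).trans (min_le_left _ _)))
  have hεH' : ε < εH := hε₁.trans_le ((min_le_left _ _).trans ((min_le_right _ _).trans (min_le_right _ _)))
  have hεP' : ε < εP := hε₁.trans_le (min_le_right _ _)
  obtain ⟨n₀, δs, hδs, cs, hcs, Hs⟩ := HS hε hεs'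
  obtain ⟨rQ, δQ, hδQ, cQ, hcQ, hQ⟩ := HQ hε hεQ'
  obtain ⟨rL, δL, hδL, β₀, hβ₀, cL, hcL, hL⟩ := HL hε hεL'
  obtain ⟨nH, δH, hδH, CH₀, hH⟩ := HH hε hεH'
  obtain ⟨rP, HP⟩ := HP hε hεP'
  -- RSW below Werner's length and at `1/2`, for the gluing events
  obtain ⟨ε', hε', hε'2, hLen⟩ := charLengthW_le_charLength_of_gt hε
  obtain ⟨η, hη, -, hRSW⟩ := exists_pow_le_triLRCrossingProb_below hε' hε'2
  obtain ⟨c₀, hc₀, h0⟩ := tri_rsw_half_holds 98 (by norm_num)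
  set θ : ℝ := min (η ^ 97) c₀ with hθ
  have hθ0 : 0 < θ := lt_min (pow_pos hη _) hc₀
  set g : ℝ := θ ^ 73 with hg
  have hg0 : 0 < g := pow_pos hθ0 _
  set β : ℝ := min β₀ 1 with hβdef
  have hβ : 0 < β := lt_min hβ₀ one_pos
  have hβ1 : β ≤ 1 := min_le_right _ _
  have hβ2 : β ≤ 2 := hβ1.trans one_le_two
  have hββ₀ : β ≤ β₀ := min_le_left _ _
  set CH : ℝ := max CH₀ 0 with hCHdef
  have hCH : 0 ≤ CH := le_max_right _ _
  -- the host constants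
  set cH : ℝ := cs * cs * (g ^ 2 * g ^ 2) with hcHdef
  have hcH : 0 < cH := by positivity
  set cE : ℝ := cs * (cs * (cL / 64)) * (g ^ 2 * g ^ 2) with hcEdef
  have hcE : 0 < cE := by positivity
  refine ⟨max (max (max rQ rL) (max n₀ rP)) 64, fun r₀ hr₀ => ?_⟩
  have hrQ : rQ ≤ r₀ := le_trans (le_trans (le_max_left _ _) (le_max_left _ _)) (le_trans (le_max_left _ _) hr₀)
  have hrL : rL ≤ r₀ := le_trans (le_trans (le_max_right _ _) (le_max_left _ _)) (le_trans (le_max_left _ _) hr₀)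
  have hrn₀ : n₀ ≤ r₀ := le_trans (le_trans (le_max_left _ _) (le_max_right _ _)) (le_trans (le_max_left _ _) hr₀)
  have hrP : rP ≤ r₀ := le_trans (le_trans (le_max_right _ _) (le_max_right _ _)) (le_trans (le_max_left _ _) hr₀)
  have hr64 : 64 ≤ r₀ := le_trans (le_max_right _ _) hr₀
  have hr1 : 1 ≤ r₀ := le_trans (by norm_num) hr64
  obtain ⟨nP, δP, hδP, cP, hcP, hP⟩ := HP r₀ hrP
  -- the threshold radius `rH` of the host gluing and the constant of the pivotal sum
  obtain ⟨rH, hrHdef⟩ : ∃ rH : ℕ, rH = 2 * r₀ + n₀ + 128 := ⟨_, rfl⟩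
  obtain ⟨K₀, hK₀def⟩ : ∃ K₀ : ℕ, K₀ = 8 * (4 * r₀ + 1) + 8 * rL + 2 * rH + nH + 66 := ⟨_, rfl⟩
  set Kbig : ℝ := 18 * (K₀ : ℝ) ^ 2 * ((K₀ : ℝ) ^ 2 / (cQ * cL ^ 2 * cE * (r₀ : ℝ) ^ 2)) +
      24 * (1 + 1 / β) * (324 / (cH * cQ * cL) + 66564 / (cE * cQ * cL)) +
      18 * (1 + 1 / β) * (192 * CH / (cE * cQ * cL)) +
      18 * (32 * CH * (K₀ : ℝ) ^ 2 / (cE * cL)) with hKbigdef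
  have hr00 : (0 : ℝ) < r₀ := by exact_mod_cast (show 0 < r₀ by omega)
  have hKbig0 : 0 ≤ Kbig := by rw [hKbigdef]; positivity
  set Kg : ℝ := Kbig / cP with hKgdef
  have hKg0 : 0 ≤ Kg := div_nonneg hKbig0 hcP.le
  refine ⟨max (128 * K₀ + 20000) nP, min (min (min δs δQ) (min δL δH)) (min δP (1 / 4)), by positivity,
    cE * Real.exp (-Kg), by positivity, Real.exp Kg / cE, fun p hp1 hp2 N hN hNL => ?_⟩
  have hN1 : 128 * K₀ + 20000 ≤ N := le_trans (le_max_left _ _) hN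
  have hNP : nP ≤ N := le_trans (le_max_right _ _) hN
  have hδle : ∀ {x : ℝ}, x < 1 / 2 + min (min (min δs δQ) (min δL δH)) (min δP (1 / 4)) →
      x < 1 / 2 + δs ∧ x < 1 / 2 + δQ ∧ x < 1 / 2 + δL ∧ x < 1 / 2 + δH ∧ x < 1 / 2 + δP ∧ x < 3 / 4 := by
    intro x hx
    refine ⟨?_, ?_, ?_, ?_, ?_, ?_⟩ <;>
      linarith [min_le_left (min (min δs δQ) (min δL δH)) (min δP (1 / 4)),
        min_le_right (min (min δs δQ) (min δL δH)) (min δP (1 / 4)),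
        min_le_left (min δs δQ) (min δL δH), min_le_right (min δs δQ) (min δL δH),
        min_le_left δs δQ, min_le_right δs δQ, min_le_left δL δH, min_le_right δL δH,
        min_le_left δP (1 / 4), min_le_right δP (1 / 4)]
  set E : Set (SiteConfig (Site 2)) := landedAltFourArm r₀ N with hEdef
  ----------------------------------------------------------------------------------------------
  -- ALL INPUTS AT A PARAMETER `t` WITH `1/2 ≤ t < 1/2 + δ` AND `N ≤ L(t, ε)` IF `t > 1/2`
  ----------------------------------------------------------------------------------------------
  have hAll : ∀ t : unitInterval, 1 / 2 ≤ (t : ℝ) →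
      (t : ℝ) < 1 / 2 + min (min (min δs δQ) (min δL δH)) (min δP (1 / 4)) →
      (1 / 2 < (t : ℝ) → N ≤ charLengthW ε t) →
      (∑ v ∈ triAnnulus r₀ N, (triSitePercolation t).real {ω | IsPivotal E v ω} ≤
          Kg * paraPivotalSum t N * (triSitePercolation t).real E) ∧
        cE * altFourArmProbAt t r₀ N ≤ (triSitePercolation t).real E := by
    intro t ht1 ht2 htL
    obtain ⟨htδs, htδQ, htδL, htδH, htδP, ht34⟩ := hδle ht2
    have nn : ∀ a b : ℕ, 0 ≤ altFourArmProbAt t a b := fun a b => altFourArmProbAt_nonneg t a b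
    have anti : ∀ {a b b' : ℕ}, a ≤ b → b ≤ b' → altFourArmProbAt t a b' ≤ altFourArmProbAt t a b :=
      fun hab hbb => altFourArmProbAt_anti t _ hab hbb
    have monoL : ∀ {a a' b : ℕ}, a ≤ a' → a' ≤ b → altFourArmProbAt t a b ≤ altFourArmProbAt t a' b :=
      fun haa hab => altFourArmProbAt_mono_left t haa hab
    -- (a) kernel quasi-multiplicativity at the inner radius `r₀`
    have hQt : ∀ R S : ℕ, 16 * r₀ < 4 * R → 4 * R < S → S ≤ N →
        cQ * (altFourArmProbAt t r₀ R * altFourArmProbAt t (4 * R) S) ≤ altFourArmProbAt t r₀ S :=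
      fun R S h1 h2 h3 => hQ t ht1 htδQ r₀ R S hrQ h1 h2 fun hgt => h3.trans (htL hgt)
    -- (b) kernel lower bound, exponent weakened to `β = min β₀ 1`
    have hLt : ∀ m n : ℕ, rL ≤ m → m ≤ n → n ≤ N →
        cL * ((m : ℝ) / n) ^ (2 - β) ≤ altFourArmProbAt t m n := by
      intro m n h1 h2 h3
      have h := hL t ht1 htδL m n h1 h2 fun hgt => h3.trans (htL hgt)
      refine le_trans (mul_le_mul_of_nonneg_left ?_ hcL.le) h
      rcases Nat.eq_zero_or_pos m with hm | hm
      · subst hm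
        simp only [CharP.cast_eq_zero, zero_div]
        rw [Real.zero_rpow (ne_of_gt (by linarith))]
        exact Real.rpow_nonneg le_rfl _
      · have hn : 0 < n := by omega
        apply Real.rpow_le_rpow_of_exponent_ge
        · exact div_pos (by exact_mod_cast hm) (by exact_mod_cast hn)
        · rw [div_le_one (by exact_mod_cast hn)]; exact_mod_cast h2
        · linarith
    -- (c) separation below `N`
    have sepAt : ∀ n M : ℕ, n₀ ≤ n → 2 * n ≤ M → M ≤ N →
        cs * altFourArmProbAt t n M ≤ (triSitePercolation t).real (sepFourArm n M) :=
      fun n M hn h2 hMN => Hs t ht1 htδs n M hn h2 fun hgt => hMN.trans (htL hgt)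
    -- (d) RSW below `N`, at `t` and at `1 - t`; the gluing events
    have key : ∀ Q : ℕ, 64 * Q < N → ∀ q : unitInterval, (q = t ∨ q = σ t) →
        ∀ w h : ℕ, 1 ≤ h → h ≤ 64 * Q → w ≤ 98 * h → θ ≤ triLRCrossingProb q w h := by
      intro Q hQN q hq w h h1 hh hw
      have hanti : triLRCrossingProb q (98 * h) h ≤ triLRCrossingProb q w h := triLRCrossingProb_anti_width q hw h
      refine le_trans ?_ hanti
      rcases eq_or_lt_of_le ht1 with heq | hgt
      · have ht : t = half := Subtype.ext (by rw [coe_half]; exact heq.symm)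
        have hq' : q = half := by
          rcases hq with rfl | rfl
          · exact ht
          · rw [ht, symm_half]
        have hfl : ⌊(98 : ℝ) * h⌋₊ = 98 * h := by
          have : (98 : ℝ) * h = ((98 * h : ℕ) : ℝ) := by push_cast; ring
          rw [this, Nat.floor_natCast]
        have := (h0 h (by rw [hfl]; omega)).1
        rw [hfl] at this
        rw [hq']
        exact (min_le_right _ _).trans this
      · have hhL : h < charLength ε' t :=
          lt_of_lt_of_le (by omega : h < N) ((htL hgt).trans (hLen t hgt ht34))
        have hqmin : min t (σ t) ≤ q := by
          rcases hq with rfl | rfl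
          · exact min_le_left _ _
          · exact min_le_right _ _
        have := hRSW t q hqmin h h1 hhL 97 (98 * h) (by norm_num) (by omega)
        exact (min_le_left _ _).trans this
    have hG : ∀ Q : ℕ, 1 ≤ Q → 64 * Q < N →
        g ^ 2 * g ^ 2 ≤ (triSitePercolation t).real (fourGlue Q) ^ 2 *
          (triSitePercolation (σ t)).real (fourGlue Q) ^ 2 := by
      intro Q hQ1 hQN
      obtain ⟨gt, -⟩ := le_real_fourGlue_of_rsw t hQ1 hθ0.le (key Q hQN t (Or.inl rfl))
      obtain ⟨gs, -⟩ := le_real_fourGlue_of_rsw (σ t) hQ1 hθ0.le (key Q hQN (σ t) (Or.inr rfl))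
      exact mul_le_mul (pow_le_pow_left₀ hg0.le gt 2) (pow_le_pow_left₀ hg0.le gs 2) (pow_nonneg hg0.le 2)
        (pow_nonneg measureReal_nonneg 2)
    -- (e) host gluing: `cH π̂^alt(r₀, m) π̂^alt(m', N) ≤ P_t(E)`
    have hHost : ∀ m m' : ℕ, rH ≤ m → m' ≤ 8 * m → 16 * m + 1024 ≤ N →
        cH * (altFourArmProbAt t r₀ m * altFourArmProbAt t m' N) ≤ (triSitePercolation t).real E := by
      intro m m' hm hm' hmN
      set q : ℕ := m / 64 with hq
      have hdm := Nat.div_add_mod m 64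
      have hml := Nat.mod_lt m (by norm_num : 64 > 0)
      have hqm : 64 * q ≤ m := by omega
      have hmq : m < 64 * (q + 1) := by omega
      have hq1 : 1 ≤ q := by omega
      have hQN' : 1024 * q + 1024 ≤ N := by omega
      have hQN : 2 * (512 * (q + 1)) ≤ N :=
        calc 2 * (512 * (q + 1)) = 1024 * q + 1024 := by ring
          _ ≤ N := hQN'
      have h512N : 512 * (q + 1) ≤ N := le_trans (Nat.le_mul_of_pos_left _ (by norm_num)) hQN
      have hQn₀ : n₀ ≤ 512 * (q + 1) := by omega
      have glue := sepFour_mul_sepFour_mul_glue_le_landed_at t (q := q) (n₁ := r₀) (n₃ := N) hq1 (by omega)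
        (by omega) h512N
      have s1 : cs * altFourArmProbAt t r₀ m ≤ (triSitePercolation t).real (sepFourArm r₀ (64 * q)) :=
        le_trans (mul_le_mul_of_nonneg_left (anti (by omega) hqm) hcs.le) (sepAt r₀ (64 * q) hrn₀ (by omega) (by omega))
      have s2 : cs * altFourArmProbAt t m' N ≤ (triSitePercolation t).real (sepFourArm (512 * (q + 1)) N) :=
        le_trans (mul_le_mul_of_nonneg_left (monoL (by omega) h512N) hcs.le)
          (sepAt (512 * (q + 1)) N hQn₀ hQN le_rfl)
      have hGG := hG q hq1 (by omega)
      calc cH * (altFourArmProbAt t r₀ m * altFourArmProbAt t m' N)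
          = (cs * altFourArmProbAt t r₀ m) * (cs * altFourArmProbAt t m' N) * (g ^ 2 * g ^ 2) := by
            rw [hcHdef]; ring
        _ ≤ (triSitePercolation t).real (sepFourArm r₀ (64 * q)) *
              (triSitePercolation t).real (sepFourArm (512 * (q + 1)) N) *
              ((triSitePercolation t).real (fourGlue q) ^ 2 * (triSitePercolation (σ t)).real (fourGlue q) ^ 2) :=
            mul_le_mul (mul_le_mul s1 s2 (mul_nonneg hcs.le (nn _ _)) measureReal_nonneg) hGG
              (mul_nonneg (pow_nonneg hg0.le 2) (pow_nonneg hg0.le 2))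
              (mul_nonneg measureReal_nonneg measureReal_nonneg)
        _ ≤ (triSitePercolation t).real E := glue
    -- (f) host extension: `cE π̂^alt(r₀, M) ≤ P_t(E)` for `N/64 ≤ M ≤ N/16 - 64`
    have hExt : ∀ M : ℕ, N / 64 ≤ M → M ≤ N / 16 - 64 →
        cE * altFourArmProbAt t r₀ M ≤ (triSitePercolation t).real E := by
      intro M hM1 hM2
      set q : ℕ := M / 64 with hq
      have hdm := Nat.div_add_mod M 64
      have hml := Nat.mod_lt M (by norm_num : 64 > 0)
      have hqM : 64 * q ≤ M := by omega
      have hMq : M < 64 * (q + 1) := by omega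
      have hq1 : 1 ≤ q := by omega
      have hQN' : 1024 * q + 1024 ≤ N := by omega
      have hQN : 2 * (512 * (q + 1)) ≤ N :=
        calc 2 * (512 * (q + 1)) = 1024 * q + 1024 := by ring
          _ ≤ N := hQN'
      have h512N : 512 * (q + 1) ≤ N := le_trans (Nat.le_mul_of_pos_left _ (by norm_num)) hQN
      have hQn₀ : n₀ ≤ 512 * (q + 1) := by omega
      have glue := sepFour_mul_sepFour_mul_glue_le_landed_at t (q := q) (n₁ := r₀) (n₃ := N) hq1 (by omega)
        (by omega) h512N
      have s1 : cs * altFourArmProbAt t r₀ M ≤ (triSitePercolation t).real (sepFourArm r₀ (64 * q)) :=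
        le_trans (mul_le_mul_of_nonneg_left (anti (by omega) hqM) hcs.le) (sepAt r₀ (64 * q) hrn₀ (by omega) (by omega))
      -- the outer factor is bounded below: `π̂^alt(512(q+1), N) ≥ cL (1/8)²`
      have hNpos : (0 : ℝ) < N := by exact_mod_cast (show 0 < N by omega)
      have hx1 : ((512 * (q + 1) : ℕ) : ℝ) / N ≤ 1 := by
        rw [div_le_one hNpos]; exact_mod_cast h512N
      have hx0 : (0 : ℝ) < ((512 * (q + 1) : ℕ) : ℝ) / N := div_pos (by positivity) hNpos
      have hx8 : (1 / 8 : ℝ) ≤ ((512 * (q + 1) : ℕ) : ℝ) / N := by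
        rw [le_div_iff₀ hNpos]
        have h' : N ≤ 4096 * q + 4096 := by omega
        have : (N : ℝ) ≤ 8 * ((512 * (q + 1) : ℕ) : ℝ) := by
          have h'' : (N : ℝ) ≤ 4096 * (q : ℝ) + 4096 := by exact_mod_cast h'
          push_cast
          linarith
        linarith
      have hlow : cL / 64 ≤ altFourArmProbAt t (512 * (q + 1)) N := by
        have h := hLt (512 * (q + 1)) N (by omega) h512N le_rfl
        refine le_trans ?_ h
        have h2 : ((1 : ℝ) / 8) ^ 2 ≤ (((512 * (q + 1) : ℕ) : ℝ) / N) ^ (2 - β) :=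
          le_trans (pow_le_pow_left₀ (by norm_num) hx8 2) (sq_le_rpow_two_sub hx0 hx1 hβ.le)
        calc cL / 64 = cL * ((1 : ℝ) / 8) ^ 2 := by ring
          _ ≤ _ := mul_le_mul_of_nonneg_left h2 hcL.le
      have s2 : cs * (cL / 64) ≤ (triSitePercolation t).real (sepFourArm (512 * (q + 1)) N) :=
        le_trans (mul_le_mul_of_nonneg_left hlow hcs.le) (sepAt (512 * (q + 1)) N hQn₀ hQN le_rfl)
      have hGG := hG q hq1 (by omega)
      calc cE * altFourArmProbAt t r₀ M
          = (cs * altFourArmProbAt t r₀ M) * (cs * (cL / 64)) * (g ^ 2 * g ^ 2) := by rw [hcEdef]; ring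
        _ ≤ (triSitePercolation t).real (sepFourArm r₀ (64 * q)) *
              (triSitePercolation t).real (sepFourArm (512 * (q + 1)) N) *
              ((triSitePercolation t).real (fourGlue q) ^ 2 * (triSitePercolation (σ t)).real (fourGlue q) ^ 2) :=
            mul_le_mul (mul_le_mul s1 s2 (by positivity) measureReal_nonneg) hGG
              (mul_nonneg (pow_nonneg hg0.le 2) (pow_nonneg hg0.le 2))
              (mul_nonneg measureReal_nonneg measureReal_nonneg)
        _ ≤ (triSitePercolation t).real E := glue
    -- (g) the half-plane two-arm bound
    have hHP : ∀ m n : ℕ, nH ≤ m → m ≤ n → n ≤ N →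
        (triSitePercolation t).real (domArmEvent ![true, false] m n upperHalfPlane) ≤ CH * ((m : ℝ) / n) := by
      intro m n h1 h2 h3
      refine (hH t ht1 htδH m n h1 h2 fun hgt => h3.trans (htL hgt)).trans ?_
      exact mul_le_mul_of_nonneg_right (le_max_left _ _) (by positivity)
    -- (h) the pivotal sum and the pivotal lower bound for the crossing
    have hN1' : 128 * (8 * (4 * r₀ + 1) + 8 * rL + 2 * rH + nH + 66) + 20000 ≤ N := by
      rw [← hK₀def]; exact hN1
    have hsum := landedPivotalSum_le hcQ hcL hcH hcE hCH hβ hβ1 hQt hLt hHost hExt hHP hr1 hrL hN1'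
    rw [← hK₀def] at hsum
    have hpara := hP t ht1 htδP N hNP htL
    refine ⟨?_, ?_⟩
    · refine hsum.trans ?_
      have hW0 : 0 ≤ (triSitePercolation t).real E := measureReal_nonneg
      have h2 : Kbig * ((N : ℝ) ^ 2 * altFourArmProbAt t r₀ N) ≤ Kg * paraPivotalSum t N := by
        rw [hKgdef, div_mul_eq_mul_div, le_div_iff₀ hcP]
        calc Kbig * ((N : ℝ) ^ 2 * altFourArmProbAt t r₀ N) * cP
            = Kbig * (cP * ((N : ℝ) ^ 2 * altFourArmProbAt t r₀ N)) := by ring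
          _ ≤ Kbig * paraPivotalSum t N := mul_le_mul_of_nonneg_left hpara hKbig0
      exact mul_le_mul_of_nonneg_right h2 hW0
    · have ha : altFourArmProbAt t r₀ N ≤ altFourArmProbAt t r₀ (N / 16 - 64) := anti (by omega) (by omega)
      exact (mul_le_mul_of_nonneg_left ha hcE.le).trans (hExt (N / 16 - 64) (by omega) le_rfl)
  ----------------------------------------------------------------------------------------------
  -- GRÖNWALL AND THE SANDWICH
  ----------------------------------------------------------------------------------------------
  have hhalf1 : (1 : ℝ) / 2 ≤ (half : ℝ) := by rw [coe_half]
  have hhalf2 : ((half : unitInterval) : ℝ) < 1 / 2 + min (min (min δs δQ) (min δL δH)) (min δP (1 / 4)) := by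
    rw [coe_half]; linarith [show (0 : ℝ) < min (min (min δs δQ) (min δL δH)) (min δP (1 / 4)) by positivity]
  obtain ⟨-, hEhalf⟩ := hAll half hhalf1 hhalf2 (fun h => absurd h (by rw [coe_half]; norm_num))
  obtain ⟨-, hEp⟩ := hAll p hp1 hp2 hNL
  have hupper : ∀ s : unitInterval, (triSitePercolation s).real E ≤ altFourArmProbAt s r₀ N :=
    fun s => real_landedAltFourArm_le_altFourArmProbAt s hr1 (by omega)
  -- the ratio `P_p(E) / P_{1/2}(E)`
  have hratio : (triSitePercolation p).real E ≤ Real.exp Kg * (triSitePercolation half).real E ∧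
      (triSitePercolation half).real E ≤ Real.exp Kg * (triSitePercolation p).real E := by
    rcases eq_or_lt_of_le hp1 with heq | hgt
    · have hp : p = half := Subtype.ext (by rw [coe_half]; exact heq.symm)
      subst hp
      have h1 : (1 : ℝ) ≤ Real.exp Kg := Real.one_le_exp hKg0
      constructor <;> exact le_mul_of_one_le_left measureReal_nonneg h1
    · obtain ⟨-, -, -, -, -, hp34⟩ := hδle hp2
      refine real_ratio_le_exp_of_pivotal_bound (N := N) (triAnnulus r₀ N) (determinedBy_landedAltFourArm (by omega))
        hgt (by linarith) hKg0 fun t ht htp => ?_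
      have htp' : (t : ℝ) < p := Subtype.coe_lt_coe.2 htp
      exact (hAll t ht.le (by linarith) fun hgt' => (hNL hgt).trans
        (charLengthW_antitone hε hgt' htp.le)).1
  obtain ⟨hr1', hr2'⟩ := hratio
  constructor
  · -- `cE e^{-Kg} π̂^alt_{1/2} ≤ π̂^alt_p`
    have h1 : cE * altFourArmProbAt half r₀ N ≤ Real.exp Kg * (triSitePercolation p).real E := hEhalf.trans hr2'
    have h2 : cE * altFourArmProbAt half r₀ N ≤ Real.exp Kg * altFourArmProbAt p r₀ N :=
      h1.trans (mul_le_mul_of_nonneg_left (hupper p) (Real.exp_pos _).le)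
    calc cE * Real.exp (-Kg) * altFourArmProbAt half r₀ N
        = Real.exp (-Kg) * (cE * altFourArmProbAt half r₀ N) := by ring
      _ ≤ Real.exp (-Kg) * (Real.exp Kg * altFourArmProbAt p r₀ N) :=
          mul_le_mul_of_nonneg_left h2 (Real.exp_pos _).le
      _ = altFourArmProbAt p r₀ N := by rw [← mul_assoc, ← Real.exp_add, neg_add_cancel, Real.exp_zero, one_mul]
  · -- `π̂^alt_p ≤ (e^{Kg}/cE) π̂^alt_{1/2}`
    have h1 : cE * altFourArmProbAt p r₀ N ≤ Real.exp Kg * (triSitePercolation half).real E := hEp.trans hr1'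
    have h2 : cE * altFourArmProbAt p r₀ N ≤ Real.exp Kg * altFourArmProbAt half r₀ N :=
      h1.trans (mul_le_mul_of_nonneg_left (hupper half) (Real.exp_pos _).le)
    rw [div_mul_eq_mul_div, le_div_iff₀ hcE, mul_comm]
    exact h2

end Literature.Probability.Percolation
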